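import Summits.CriticalPhenomena.PercolationContinuityZ3.Theorems.PercNearOneGluingNoHeavyLowerTailOutsiderPortStep
import Summits.CriticalPhenomena.PercolationContinuityZ3.Theorems.PercNearOneGluingNoHeavyLowerTailQuantitativeObserverSet
import HarnessLib

/-!
# `NoHeavyLowerTail` (stmt-CriticalPhenomena-4575) — the HEAVY OUTSIDER STEP of the two-sided kernel: an outsider no lighter than a glued port
# block is handled by the one-star argument

Support file (prover `prim-hp-3`, hull-port line; `--supports stmt-CriticalPhenomena-4575`).  No definitions, no named facts, no sorries.

Notation as in `…OutsiderPortStep.lean`: `μ_w = prodBernoulli w` on `Fin n`, relays `A`, level `j`, a finite observer set `O`, `I_w(v) = μ_w{|π(v)| ≤ j}`,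
E-mass `E_w(c) = μ_w(c ↮ O, 1 ≤ |π(O)| ≤ j) + μ_w(c ↔ O, |π(c)| ≤ j)`; a star pair `e = s(a,o)` with `o ∈ O`, `w₀ = w[e↦0]`, `w₁ = w[e↦1]`.

* `HullPort.obsE_glued_le_of_heavier` — **quantitative observer-set lemma at the glued endpoint**: if `I_{w₁}(v) ≤ I_{w₁}(a)` (the vertex `v` is no
  lighter than the port `a` once `a` is glued to its observer `o`), then `E_{w₁}(v) ≤ I_{w₁}(a)`.  (`setCS_deficit_le_excess` with the member `o`, whose
  lightness under `w₁` is `I_{w₁}(a)` by `lightness_eq_of_weight_one`, plus `obsE_lightness_split`.)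
* `HullPort.obsE_le_max_of_erase_heavy` — **the heavy outsider step**: if moreover `E_{w₀}(v) ≤ I_{w₀}(q)` for some vertex `q ≠ a` (e.g. the best port one pair
  down, by the induction hypothesis of the (DC) induction), then `E_w(v) ≤ max(I_w(a), I_w(q))`: either `q` is no lighter than `a` without `e` (then `a` is a common
  witness), or raising the own pair of `a` keeps `I(a) ≤ I(q)` (`lightness_le_of_raise_own_edge`, BHK Thm 1.5) and `q` is a common witness
  (`obsE_le_of_common_witness`).  This is literally the one-star CIL step (`obsE_le_max_of_erase`, the port case `v = a`) for an ARBITRARY vertex `v`.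
WHY (crux notes `run/shared/lean/prim/prim-hp-3/HULLPORT-REF-gen6.md` §14): in the (DC) induction (`dc_of_outsiderStepAll`) the outsider step therefore only
remains open for the LIGHT CORE — outsiders `v` strictly lighter, in every contracted instance `w[e↦1]`, than every glued port block (≈ 45 % of outsider
pairs in random designs, all 100 TPS pairs of ttrl's jointcov-hard set); for all other outsiders (DC) at `w` follows from (DC) one pair down.
-/

noncomputable section

namespace Summit.CriticalPhenomena.PercolationContinuityZ3.Theorems

open MeasureTheory Set Literature.Probability.LatticeModels Literature.Probability.Percolation
open scoped Classical BigOperators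

variable {n : ℕ}

namespace HullPort

/-- **Glued endpoint, heavy vertex.**  `o ∈ O`, `a ≠ o`, `w s(a,o) = 1` and `I_w(v) ≤ I_w(a)`: then `E_w(v) ≤ I_w(a)`.
(`setCS_deficit_le_excess` for the member `o`, `I_w(o) = I_w(a)`, and the splitting `I(v) = μ(v ↔ O, L_v) + μ(v ↮ O, L_v)`.)
[cite: VandenbergHaggstromKahn2005, Thm. 1.5 (p. 7) — via `setCS_deficit_le_excess`; this work] -/
theorem obsE_glued_le_of_heavier (w : Sym2 (Fin n) → unitInterval) (A O : Finset (Fin n)) (o a v : Fin n) (j : ℕ)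
    (ho : o ∈ O) (hao : a ≠ o) (hw : w s(a, o) = 1)
    (hheavy : (prodBernoulli w).real {ω : BondConfig (Fin n) | (A.filter fun z => ω ∈ openConn v z).card ≤ j} ≤
      (prodBernoulli w).real {ω : BondConfig (Fin n) | (A.filter fun z => ω ∈ openConn a z).card ≤ j}) :
    (prodBernoulli w).real {ω : BondConfig (Fin n) | (∀ x ∈ O, ω ∉ openConn v x) ∧
        1 ≤ (A.filter fun z => ∃ x ∈ O, ω ∈ openConn x z).card ∧
        (A.filter fun z => ∃ x ∈ O, ω ∈ openConn x z).card ≤ j} +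
      (prodBernoulli w).real {ω : BondConfig (Fin n) | (∃ x ∈ O, ω ∈ openConn v x) ∧
        (A.filter fun z => ω ∈ openConn v z).card ≤ j} ≤
      (prodBernoulli w).real {ω : BondConfig (Fin n) | (A.filter fun z => ω ∈ openConn a z).card ≤ j} := by
  have hoa : o ≠ a := fun h => hao h.symm
  have hwoa : w s(o, a) = 1 := by rw [Sym2.eq_swap]; exact hw
  have hIo : (prodBernoulli w).real {ω : BondConfig (Fin n) | (A.filter fun z => ω ∈ openConn o z).card ≤ j} =
      (prodBernoulli w).real {ω : BondConfig (Fin n) | (A.filter fun z => ω ∈ openConn a z).card ≤ j} :=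
    lightness_eq_of_weight_one w A hoa j hwoa
  have hq := setCS_deficit_le_excess w A O o v ho j
  have hsplit := obsE_lightness_split w A O v j
  rw [hIo] at hq
  have hmax : max 0 ((prodBernoulli w).real {ω : BondConfig (Fin n) | (A.filter fun z => ω ∈ openConn a z).card ≤ j} -
      (prodBernoulli w).real {ω : BondConfig (Fin n) | (A.filter fun z => ω ∈ openConn v z).card ≤ j}) =
      (prodBernoulli w).real {ω : BondConfig (Fin n) | (A.filter fun z => ω ∈ openConn a z).card ≤ j} -
        (prodBernoulli w).real {ω : BondConfig (Fin n) | (A.filter fun z => ω ∈ openConn v z).card ≤ j} :=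
    max_eq_right (by linarith)
  rw [hmax] at hq
  have hq' : (prodBernoulli w).real {ω : BondConfig (Fin n) | (∀ x ∈ O, ω ∉ openConn v x) ∧
        1 ≤ (A.filter fun z => ∃ x ∈ O, ω ∈ openConn x z).card ∧
        (A.filter fun z => ∃ x ∈ O, ω ∈ openConn x z).card ≤ j} ≤
      (prodBernoulli w).real {ω : BondConfig (Fin n) | (∀ x ∈ O, ω ∉ openConn v x) ∧
        (A.filter fun z => ω ∈ openConn v z).card ≤ j} +
      ((prodBernoulli w).real {ω : BondConfig (Fin n) | (A.filter fun z => ω ∈ openConn a z).card ≤ j} -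
        (prodBernoulli w).real {ω : BondConfig (Fin n) | (A.filter fun z => ω ∈ openConn v z).card ≤ j}) := by
    convert hq using 2
  linarith

/-- **The heavy outsider step.**  `o ∈ O`, `a ≠ o`, `q ≠ a`, `e = s(a,o)`, `w₀ = w[e↦0]`, `w₁ = w[e↦1]`.  If `I_{w₁}(v) ≤ I_{w₁}(a)` (the vertex `v` is no
lighter than the glued port) and `E_{w₀}(v) ≤ I_{w₀}(q)`, then `E_w(v) ≤ max(I_w(a), I_w(q))`.  [cite: VandenbergHaggstromKahn2005, Thm. 1.5 (p. 7) — via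
`lightness_le_of_raise_own_edge` and `obsE_glued_le_of_heavier`; this work] -/
theorem obsE_le_max_of_erase_heavy (w : Sym2 (Fin n) → unitInterval) (A O : Finset (Fin n)) (o a v q : Fin n) (j : ℕ)
    (ho : o ∈ O) (hao : a ≠ o) (hqa : q ≠ a)
    (hheavy : (prodBernoulli (Function.update w s(a, o) 1)).real {ω : BondConfig (Fin n) | (A.filter fun z => ω ∈ openConn v z).card ≤ j} ≤
      (prodBernoulli (Function.update w s(a, o) 1)).real {ω : BondConfig (Fin n) | (A.filter fun z => ω ∈ openConn a z).card ≤ j})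
    (h0 : (prodBernoulli (Function.update w s(a, o) 0)).real {ω : BondConfig (Fin n) | (∀ x ∈ O, ω ∉ openConn v x) ∧
          1 ≤ (A.filter fun z => ∃ x ∈ O, ω ∈ openConn x z).card ∧
          (A.filter fun z => ∃ x ∈ O, ω ∈ openConn x z).card ≤ j} +
        (prodBernoulli (Function.update w s(a, o) 0)).real {ω : BondConfig (Fin n) | (∃ x ∈ O, ω ∈ openConn v x) ∧
          (A.filter fun z => ω ∈ openConn v z).card ≤ j} ≤
        (prodBernoulli (Function.update w s(a, o) 0)).real
          {ω : BondConfig (Fin n) | (A.filter fun z => ω ∈ openConn q z).card ≤ j}) :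
    (prodBernoulli w).real {ω : BondConfig (Fin n) | (∀ x ∈ O, ω ∉ openConn v x) ∧
        1 ≤ (A.filter fun z => ∃ x ∈ O, ω ∈ openConn x z).card ∧
        (A.filter fun z => ∃ x ∈ O, ω ∈ openConn x z).card ≤ j} +
      (prodBernoulli w).real {ω : BondConfig (Fin n) | (∃ x ∈ O, ω ∈ openConn v x) ∧
        (A.filter fun z => ω ∈ openConn v z).card ≤ j} ≤
      max ((prodBernoulli w).real {ω : BondConfig (Fin n) | (A.filter fun z => ω ∈ openConn a z).card ≤ j})
        ((prodBernoulli w).real {ω : BondConfig (Fin n) | (A.filter fun z => ω ∈ openConn q z).card ≤ j}) := by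
  set w₀ := Function.update w s(a, o) 0 with hw₀
  set w₁ := Function.update w s(a, o) 1 with hw₁
  set Ra : (Sym2 (Fin n) → unitInterval) → ℝ := fun u =>
    (prodBernoulli u).real {ω : BondConfig (Fin n) | (A.filter fun z => ω ∈ openConn a z).card ≤ j} with hRa
  set Rq : (Sym2 (Fin n) → unitInterval) → ℝ := fun u =>
    (prodBernoulli u).real {ω : BondConfig (Fin n) | (A.filter fun z => ω ∈ openConn q z).card ≤ j} with hRq
  -- the glued endpoint: `E_{w₁}(v) ≤ I_{w₁}(a)`
  have h1 := obsE_glued_le_of_heavier w₁ A O o a v j ho hao (by simp [hw₁]) hheavy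
  by_cases hc : Rq w₀ ≤ Ra w₀
  · -- `a` is a common witness
    have h0' : (prodBernoulli w₀).real {ω : BondConfig (Fin n) | (∀ x ∈ O, ω ∉ openConn v x) ∧
          1 ≤ (A.filter fun z => ∃ x ∈ O, ω ∈ openConn x z).card ∧
          (A.filter fun z => ∃ x ∈ O, ω ∈ openConn x z).card ≤ j} +
        (prodBernoulli w₀).real {ω : BondConfig (Fin n) | (∃ x ∈ O, ω ∈ openConn v x) ∧
          (A.filter fun z => ω ∈ openConn v z).card ≤ j} ≤ Ra w₀ := h0.trans hc
    exact (obsE_le_of_common_witness w A O s(a, o) v a j h0' h1).trans (le_max_left _ _)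
  · -- `a` is strictly lighter than `q` without `e`; raising the own pair of `a` keeps `I(a) ≤ I(q)`, so `q` is a common witness
    push Not at hc
    have hw₀e : w₀ s(a, o) = 0 := by simp [hw₀]
    have hw₁' : w₁ = Function.update w₀ s(a, o) 1 := by rw [hw₁, hw₀, Function.update_idem]
    have hraise : Ra w₁ ≤ Rq w₁ := by
      have h := lightness_le_of_raise_own_edge w A a o q j hao hqa 0 1 (by norm_num) (le_of_lt hc)
      exact h
    have h1' : (prodBernoulli w₁).real {ω : BondConfig (Fin n) | (∀ x ∈ O, ω ∉ openConn v x) ∧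
          1 ≤ (A.filter fun z => ∃ x ∈ O, ω ∈ openConn x z).card ∧
          (A.filter fun z => ∃ x ∈ O, ω ∈ openConn x z).card ≤ j} +
        (prodBernoulli w₁).real {ω : BondConfig (Fin n) | (∃ x ∈ O, ω ∈ openConn v x) ∧
          (A.filter fun z => ω ∈ openConn v z).card ≤ j} ≤ Rq w₁ := h1.trans hraise
    exact (obsE_le_of_common_witness w A O s(a, o) v q j h0 h1').trans (le_max_right _ _)

end HullPort

end Summit.CriticalPhenomena.PercolationContinuityZ3.Theorems

end
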